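import Mathlib
import Summits.Ventures.HodgeRepro.OcticCMPointEightIdeal
import Summits.Ventures.HodgeRepro.GaussSumTwistExists

/-!
# OcticCMPointEightSign — the conductor-`8` root numbers at `𝔭₁, 𝔭₂ | 5` of the octic point

Blind re-derivation cell `pub-hodge-repro`, seat night-2 (gen 5).  Target tree path
`lean/Summits/Ventures/HodgeRepro/OcticCMPointEightSign.lean`.  On the ring `R8 = 𝒪/𝔭⁸ = ℤ/25[w]/(w⁴ + 5w² + 5)`
of `OcticCMPointEightModel.lean` (conjugation `σ : w ↦ −w`, primitive `σ`-odd `ψ̃ = ψ₂₅ ∘ top`) with the ideal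
`I = 5 R8 = 𝔭⁴/𝔭⁸` of `OcticCMPointEightIdeal.lean` (`I · I = 0`, `ψ̃`-annihilator `I`, `|I| = 625`):

* **The even part.**  `y = evenPart y + oddPart y` (`c₀ + c₂ w²` and `c₁ w + c₃ w³`); `σ` fixes the even part and
  negates the odd one; `top` of an even element is `0`; so `σ(y) ≡ y` mod `I` forces `y ≡ evenPart y` mod `I`
  (`2` is invertible mod `25`), and the even part of a unit is a unit (`isUnit_evenPart`).
* **The conductor-`8` root numbers** (`eps_eight`): for EVERY conjugate-dual character `ρ` of conductor exactly
  `8` (`ρ(1 + z) = ψ̃(a z)` on `I`, `a` a unit — such `ρ` exist, `exists_primitive_eight`),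
  `ε(½, ρ, ψ̃) = ρ(ϖ)^n · ρ(a₀)^{−1}` with `a₀` the EVEN part of the stationary point `a` — a `σ`-fixed unit
  congruent to `a` mod `I` (`GaussSumEvenConductor.LocalChar.conj_sub_mem`) — and `ρ(a₀)² = 1`; the `ψ̃`-sign is
  `+1` because `top` of an even element is `0` (`GaussSumEvenConductor.LocalChar.eps_eq_of_conjDual`).  Hence
  (`eps_eight_of_trivial`) `ε = ρ(ϖ)^n` EXACTLY for `ρ` trivial on the `σ`-fixed units (the conjugate-orthogonal
  shape), (`E3_eight`) (E3) at `𝔭 | 5`, conductor `8`, for four such lines is the `ϖ`-part of N2, and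
  (`E3_eight_iff`) in general (E3) is an identity of the signs `ρ_j(a₀_j)`; `E3At_of_eight` feeds this into the
  chain's `E3At` by name (`PeriodCloserC7Stability.E3At_of_complex`) — the conductor-`8` twin of
  `OcticCMPointDualSign.eps_sign_of_conductor_two` (`ε = ω(ϖ)^n θ(β)`, `c = 2`) and of
  `OcticCMPointTruncFour.eps_twist_four_half` (`c = 4`).

The printed input is Kudla Prop. 3.8 (ii) / (3.32) (`book:editornd-introduction-langlands-program` p0109:L3–L11,
L33) through `PeriodCloserC7Stability.LocalChar.eps`.

**What this is not.**  The value `ρ(a₀)` for a conjugate-symplectic `ρ` (the quadratic character of `𝒪_k^×` — on no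
held page as a model statement), conductors `5`–`7`, and the four `χ′_j` of the face are NOT here.  Nothing here says
anything about the status of the Hodge conjecture for CM abelian varieties, which is NOT proved.
-/

set_option autoImplicit false

noncomputable section

open Polynomial Classical

namespace Summit.Ventures.HodgeRepro.PeriodCloser

namespace EightModel

open GaussSumStability

/-! ### The even part: the `σ`-fixed representative of a conjugate-dual stationary point -/

/-- The even part `c₀ + c₂ w²` of `y`. -/
def evenPart (y : R8) : R8 := (b4.repr y 0) • (1 : R8) + (b4.repr y 2) • w ^ 2

/-- The odd part `c₁ w + c₃ w³` of `y`. -/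
def oddPart (y : R8) : R8 := (b4.repr y 1) • w + (b4.repr y 3) • w ^ 3

/-- `y = evenPart y + oddPart y`. -/
theorem evenPart_add_oddPart (y : R8) : evenPart y + oddPart y = y := by
  conv_rhs => rw [eq_comb y]
  unfold evenPart oddPart
  abel

/-- `σ` fixes the even part. -/
theorem conj_evenPart (y : R8) : conj (evenPart y) = evenPart y := by
  unfold evenPart
  rw [map_add, map_smul, map_smul, map_one, map_pow, conj_w, neg_sq]

/-- `σ` negates the odd part. -/
theorem conj_oddPart (y : R8) : conj (oddPart y) = -oddPart y := by
  unfold oddPart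
  rw [map_add, map_smul, map_smul, map_pow, conj_w, show (-w) ^ 3 = -(w ^ 3) by ring, smul_neg, smul_neg, neg_add]

/-- `top 1 = 0`. -/
theorem top_one : top (1 : R8) = 0 := by
  have := top_w_pow 0 (by norm_num)
  rwa [pow_zero] at this

/-- `top (w²) = 0`. -/
theorem top_w_sq : top (w ^ 2) = 0 := by
  have := top_w_pow 2 (by norm_num)
  exact this

/-- `top` of the even part is `0`. -/
theorem top_evenPart (y : R8) : top (evenPart y) = 0 := by
  unfold evenPart
  rw [top_add, top_smul, top_smul, top_one, top_w_sq, mul_zero, mul_zero, add_zero]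

/-- `ψ̃` of the even part is `1`. -/
theorem psiTilde_evenPart (y : R8) : psiTilde (evenPart y) = 1 := by
  rw [psiTilde_apply, top_evenPart, AddChar.map_zero_eq_one]

/-- `σ(y) − y = −2 · oddPart y`. -/
theorem conj_sub_self (y : R8) : conj y - y = -(2 * oddPart y) := by
  conv_lhs => rw [← evenPart_add_oddPart y]
  rw [map_add, conj_evenPart, conj_oddPart]
  ring

/-- **`σ(y) ≡ y` mod `I` kills the odd part mod `I`** (`2` is invertible mod `25`: `13 · 2 = 26 ≡ 1`). -/
theorem sub_evenPart_mem (y : R8) (h : conj y - y ∈ I5) : y - evenPart y ∈ I5 := by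
  have h2 : 2 * oddPart y ∈ I5 := by
    rw [conj_sub_self] at h
    exact (I5.neg_mem_iff).1 h
  have hodd : y - evenPart y = oddPart y :=
    (eq_sub_of_add_eq (by rw [add_comm]; exact evenPart_add_oddPart y)).symm
  have h25 := twentyfive_eq_zero
  have : oddPart y = 13 * (2 * oddPart y) := by linear_combination (-(oddPart y)) * h25
  rw [hodd, this]
  exact I5.mul_mem_left 13 h2

/-- The even part of a unit `a` with `a − evenPart a ∈ I` is a unit: `evenPart a = a (1 − a⁻¹ o)` with
`o ∈ I`, `(a⁻¹ o)² = 0`. -/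
theorem isUnit_evenPart (a : R8ˣ) (h : (a : R8) - evenPart a ∈ I5) : IsUnit (evenPart (a : R8)) := by
  have hz : ((a⁻¹ : R8ˣ) : R8) * ((a : R8) - evenPart a) ∈ I5 := I5.mul_mem_left _ h
  have ho2 : (((a⁻¹ : R8ˣ) : R8) * ((a : R8) - evenPart a)) *
      (((a⁻¹ : R8ˣ) : R8) * ((a : R8) - evenPart a)) = 0 := I5_sq _ hz _ hz
  have hinv := Units.mul_inv a
  have heq : evenPart (a : R8) = (a : R8) * (1 - ((a⁻¹ : R8ˣ) : R8) * ((a : R8) - evenPart a)) := by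
    linear_combination ((a : R8) - evenPart a) * hinv
  rw [heq]
  refine a.isUnit.mul (IsUnit.of_mul_eq_one (1 + ((a⁻¹ : R8ˣ) : R8) * ((a : R8) - evenPart a)) ?_)
  linear_combination -ho2

/-! ### The conductor-`8` root numbers -/

/-- **A conductor-`8` character exists** for every `a`: `ρ(1 + z) = ψ̃(a z)` on `I` (gen 1's extension theorem). -/
theorem exists_primitive_eight (a : R8) : ∃ ρ : MulChar R8 ℂ, ∀ z ∈ I5, ρ (1 + z) = psiTilde (a * z) :=
  exists_primitive_mulChar psiTilde I5 I5_sq a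

/-- **The conductor-`8` root number at `𝔭 | 5` of a conjugate-dual character**: for `ρ` with `ρ ∘ σ = ρ⁻¹` on the
units and `ρ(1 + z) = ψ̃(a z)` on `I = 5 R8` (`a` a unit: conductor exactly `8`), there is a `σ`-fixed unit `a₀ ≡ a`
mod `I` (the even part of `a`) with `ρ(a₀)² = 1` and
`ε(½, ρ, ψ̃) = ρ(ϖ)^n · ρ(a₀)^{−1}` (`κ = 1/625 = |𝒪/𝔭⁸|^{−1/2}`). -/
theorem eps_eight (n : ℕ) (ρ : LocalChar R8) (hσ : ∀ x, ρ.unit (conj x) = ρ.unit⁻¹ x) (a : R8ˣ)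
    (hρ : LocalChar.Primitive psiTilde I5 ρ a) :
    ∃ a₀ : R8ˣ, conj (a₀ : R8) = a₀ ∧ (a : R8) - a₀ ∈ I5 ∧ ρ.unit (a₀ : R8) * ρ.unit (a₀ : R8) = 1 ∧
      LocalChar.eps (1 / 625) n ρ psiTilde = ρ.piVal ^ n * (ρ.unit (a₀ : R8))⁻¹ := by
  have hσ' : ∀ x, ρ.unit (σ8 x) = ρ.unit⁻¹ x := fun x => by rw [σ8_apply]; exact hσ x
  have hψσ : ∀ x, psiTilde (σ8 x) = psiTilde (-x) := fun x => by rw [σ8_apply]; exact psiTilde_conj x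
  have hconj : σ8 (a : R8) - a ∈ I5 :=
    LocalChar.conj_sub_mem psiTilde I5 psiAnn_I5_iff σ8 (fun x => by rw [σ8_apply, σ8_apply]; exact conj_conj x)
      (fun z hz => by rw [σ8_apply]; exact conj_mem_I5 z hz) hψσ ρ hσ' a hρ
  rw [σ8_apply] at hconj
  have hodd := sub_evenPart_mem a hconj
  have hu := isUnit_evenPart a hodd
  obtain ⟨h1, h2, -⟩ := LocalChar.eps_eq_of_conjDual (1 / 625) n ρ psiTilde I5 I5_sq psiAnn_I5_iff σ8 hσ' hψσ a hρ
    kappa_mul_card hu.unit (by rw [IsUnit.unit_spec, σ8_apply]; exact conj_evenPart _)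
    (by rw [IsUnit.unit_spec]; exact hodd)
  refine ⟨hu.unit, ?_, ?_, h2, ?_⟩
  · rw [IsUnit.unit_spec]
    exact conj_evenPart _
  · rw [IsUnit.unit_spec]
    exact hodd
  · rw [h1, IsUnit.unit_spec, psiTilde_evenPart, mul_one]

/-- **`ε(½, ρ, ψ̃) = ρ(ϖ)^n` exactly** for a conjugate-dual `ρ` of conductor exactly `8` that is trivial on the
`σ`-fixed units (the conjugate-orthogonal shape). -/
theorem eps_eight_of_trivial (n : ℕ) (ρ : LocalChar R8) (hσ : ∀ x, ρ.unit (conj x) = ρ.unit⁻¹ x)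
    (hfix : ∀ u : R8ˣ, conj (u : R8) = u → ρ.unit (u : R8) = 1) (a : R8ˣ)
    (hρ : LocalChar.Primitive psiTilde I5 ρ a) :
    LocalChar.eps (1 / 625) n ρ psiTilde = ρ.piVal ^ n := by
  obtain ⟨a₀, hσa₀, -, -, heps⟩ := eps_eight n ρ hσ a hρ
  rw [heps, hfix a₀ hσa₀, inv_one, mul_one]

/-- **(E3) at `𝔭 | 5`, conductor `8`, for four conjugate-dual lines trivial on the `σ`-fixed units**: the
`ϖ`-part `π₀π₁ = π₂π₃` of N2 gives `ε₀ε₁ = ε₂ε₃`. -/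
theorem E3_eight (n : ℕ) (ρ : Fin 4 → LocalChar R8) (hσ : ∀ j x, (ρ j).unit (conj x) = (ρ j).unit⁻¹ x)
    (hfix : ∀ j (u : R8ˣ), conj (u : R8) = u → (ρ j).unit (u : R8) = 1) (a : Fin 4 → R8ˣ)
    (hρ : ∀ j, LocalChar.Primitive psiTilde I5 (ρ j) (a j))
    (hN2 : (ρ 0).piVal * (ρ 1).piVal = (ρ 2).piVal * (ρ 3).piVal) :
    LocalChar.eps (1 / 625) n (ρ 0) psiTilde * LocalChar.eps (1 / 625) n (ρ 1) psiTilde =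
      LocalChar.eps (1 / 625) n (ρ 2) psiTilde * LocalChar.eps (1 / 625) n (ρ 3) psiTilde := by
  rw [eps_eight_of_trivial n (ρ 0) (hσ 0) (hfix 0) (a 0) (hρ 0), eps_eight_of_trivial n (ρ 1) (hσ 1) (hfix 1) (a 1) (hρ 1),
    eps_eight_of_trivial n (ρ 2) (hσ 2) (hfix 2) (a 2) (hρ 2), eps_eight_of_trivial n (ρ 3) (hσ 3) (hfix 3) (a 3) (hρ 3),
    ← mul_pow, hN2, mul_pow]

/-- **The sign structure in general**: for four conjugate-dual lines of conductor exactly `8`,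
`ε₀ε₁ = ε₂ε₃` iff `(π₀π₁)^n s₀ s₁ = (π₂π₃)^n s₂ s₃` with `s_j = ρ_j(a₀_j)^{−1}` the signs at the even parts. -/
theorem E3_eight_iff (n : ℕ) (ρ : Fin 4 → LocalChar R8) (hσ : ∀ j x, (ρ j).unit (conj x) = (ρ j).unit⁻¹ x)
    (a : Fin 4 → R8ˣ) (hρ : ∀ j, LocalChar.Primitive psiTilde I5 (ρ j) (a j)) :
    ∃ a₀ : Fin 4 → R8ˣ, (∀ j, conj (a₀ j : R8) = a₀ j) ∧ (∀ j, (a j : R8) - a₀ j ∈ I5) ∧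
      (∀ j, (ρ j).unit (a₀ j : R8) * (ρ j).unit (a₀ j : R8) = 1) ∧
      ((LocalChar.eps (1 / 625) n (ρ 0) psiTilde * LocalChar.eps (1 / 625) n (ρ 1) psiTilde =
          LocalChar.eps (1 / 625) n (ρ 2) psiTilde * LocalChar.eps (1 / 625) n (ρ 3) psiTilde) ↔
        ((ρ 0).piVal * (ρ 1).piVal) ^ n * (((ρ 0).unit (a₀ 0 : R8))⁻¹ * ((ρ 1).unit (a₀ 1 : R8))⁻¹) =
          ((ρ 2).piVal * (ρ 3).piVal) ^ n * (((ρ 2).unit (a₀ 2 : R8))⁻¹ * ((ρ 3).unit (a₀ 3 : R8))⁻¹)) := by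
  choose a₀ hσa₀ hsub hsq heps using fun j => eps_eight n (ρ j) (hσ j) (a j) (hρ j)
  refine ⟨a₀, hσa₀, hsub, hsq, ?_⟩
  rw [heps 0, heps 1, heps 2, heps 3, mul_pow, mul_pow]
  constructor <;> intro h <;> linear_combination h

open NumberField in
/-- **(E3) at a place of `S₃` of a face from the conductor-`8` model, by the chain's name**: if the face's four
local signs at `v` are the model's `ε(½, ρ_j, ψ̃)` for conjugate-dual `ρ_j` of conductor exactly `8` trivial on the
`σ`-fixed units, with `π₀π₁ = π₂π₃`, then `E3At I v d` (`PeriodCloserC7Stability.E3At_of_complex`); the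
identification `he` is the only input left, as in `OcticCMPointDualSign.E3At_of_tameWild`. -/
theorem E3At_of_eight {L : Type} [Field L] [NumberField L] [IsCMField L] (I : C7Face L) (v : I.Place)
    (d : I.Datum) (n : ℕ) (ρ : Fin 4 → LocalChar R8) (hσ : ∀ j x, (ρ j).unit (conj x) = (ρ j).unit⁻¹ x)
    (hfix : ∀ j (u : R8ˣ), conj (u : R8) = u → (ρ j).unit (u : R8) = 1) (a : Fin 4 → R8ˣ)
    (hρ : ∀ j, LocalChar.Primitive psiTilde I5 (ρ j) (a j))
    (hN2 : (ρ 0).piVal * (ρ 1).piVal = (ρ 2).piVal * (ρ 3).piVal)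
    (he : ∀ j, ((I.localRootNumber v (I.chars d j) : ℤ) : ℂ) = LocalChar.eps (1 / 625) n (ρ j) psiTilde) :
    E3At I v d :=
  E3At_of_complex I v d (fun j => LocalChar.eps (1 / 625) n (ρ j) psiTilde) he
    (E3_eight n ρ hσ hfix a hρ hN2)

end EightModel

end Summit.Ventures.HodgeRepro.PeriodCloser

end
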